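import Literature.Analysis.FluidPDE.KatoUniqueness
import Literature.Analysis.FluidPDE.KatoUniquenessEstimate
import Literature.Analysis.FluidPDE.SolenoidalSlabDuality
import Literature.Analysis.FluidPDE.ContinuousInLpTail
import HarnessLib

/-!
# Uniqueness of mild solutions in `C([0,T); L³)`: assembly and discharge

Analysis/FluidPDE file closing the `L²`-duality proof of the uniqueness theorem of
Furioli–Lemarié-Rieusset–Terraneo (Rev. Mat. Iberoam. 16 (2000), Thm. 1; Lemarié-Rieusset 2016,
Thm. 7.7, p. 147, proof pp. 147–151) in the tree's very weak formulation:

* `Literature.Analysis.FluidPDE.IsMildNSSolutionOn.ae_eq_Ico_of_ae_eq_Icc_three_holds` discharges the local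
  forward-uniqueness fact of `KatoUniqueness.lean`;
* `Literature.Analysis.FluidPDE.IsMildNSSolutionOn.ae_eq_of_continuousInLpOn_three_holds` discharges the accepted
  fact `Fluid.IsMildNSSolutionOn.ae_eq_of_continuousInLpOn_three` of `MildSolution.lean`
  (uniqueness of mild solutions in `C([0,T); L³)` on a three-dimensional space);
* `Literature.Analysis.FluidPDE.kato_unique_holds` discharges **ns.S13** `Literature.Analysis.FluidPDE.kato_unique` (`MildSolutions.lean`).

`KatoUniqueness.lean` reduced both facts to local forward uniqueness from a coincidence time
`τ₀` (`Fluid.IsMildNSSolutionOn.ae_eq_Ico_of_ae_eq_Icc_three`); its `L²`-duality proof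
(Lemarié-Rieusset 2016, proof of Thm. 7.7, pp. 147–151, maximal-regularity form of
Monniaux / Lions–Masmoudi, pp. 150–151) consists of

1. the a priori `L²` bound on `w = u - v` (`KatoUniquenessPairing.lean`),
2. the duality identity `∫∫⟪w, Θ⟫ = ∫∫ (⟪w, D𝒰[Θ] u⟫ + ⟪v, D𝒰[Θ] w⟫)` (`KatoUniquenessDual.lean`),
3. the smallness estimate `|∫∫⟪w, Θ⟫| ≤ (2ε n C_S (n/ν²)^{1/2} + 2λ (2(τ₁-τ₀)/ν)^{1/2}) ‖w‖ ‖Θ‖`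
   (`KatoUniquenessEstimate.lean`),
4. the closing step: density of solenoidal space–time tests in `L²(τ₀,τ₁; L²_σ)` and the
   contraction `‖w‖² ≤ κ‖w‖²` (`SolenoidalSlabDuality.lean`),
5. from a.e. `t` to every `t` by continuity in `L³`, and the choice of parameters (this file).

## This file

* `ContinuousInLpOn.exists_forall_eLpNorm_le` (uniform `L^p` bound on compact time sets) and
  `ContinuousInLpOn.ae_eq_of_ae_restrict_Ioc` (a.e.-in-time coincidence of two `C(S; L^p)`
  fields on an interval is everywhere coincidence: Lebesgue-null sets have dense complement and
  the coincidence set is closed, `ContinuousInLpOn.ae_eq_of_neBot`);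
* `IsMildNSSolutionOn.ae_eq_Ico_of_slab_estimate`: the assembly `3 ⇒ local forward uniqueness
  on the slab`, with the estimate on a given slab `(τ₀, τ₁]`, `κ < 1`, as a hypothesis
  (steps 1, 4, 5);
* `IsMildNSSolutionOn.ae_eq_Ico_of_ae_eq_Icc_three_holds`: the choice of parameters in step 3
  (Lemarié-Rieusset 2016, p. 151, step 5, `‖w‖ ≤ C A(τ) ‖w‖` with `C A(τ) < 1`): with `C_S` the
  Gagliardo–Nirenberg–Sobolev constant and `A = 6 C_S (3/ν²)^{1/2}`, take the tail size
  `ε = 1/(4A + 4)`, a common height `λ` making the `L³` tails of `u` and `v` at most `ε` on the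
  compact window `[0, (τ₀+T)/2]` (`ContinuousInLpOn.exists_forall_eLpNorm_indicator_le`,
  `ContinuousInLpTail.lean`), and `τ₁ = min ((τ₀+T)/2) (τ₀ + ν/(128 λ² + 1))`; then the
  constant is `εA + 2λ (2(τ₁-τ₀)/ν)^{1/2} ≤ 1/4 + 1/4 < 1`. The rest is bookkeeping between the
  `ℝ≥0∞`-valued estimate and the real form of the assembly
  (`lintegral_lintegral_enorm_sq_eq_ofReal`).

## References

* P. G. Lemarié-Rieusset, *The Navier–Stokes problem in the 21st century*, CRC Press 2016,
  Thm. 7.7 (p. 147) and its proof, pp. 147–151 (PDF pp. 169–173 of doi:10.1201/b19556).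
  Bib key `LemarieRieusset2016`.
* G. Furioli, P. G. Lemarié-Rieusset, E. Terraneo, *Unicité dans `L³(ℝ³)` et d'autres espaces
  fonctionnels limites pour Navier–Stokes*, Rev. Mat. Iberoam. 16 (2000), 605–667, Théorème 1
  (p. 606). Bib key `FurioliLemarierieussetTerraneo2000`.
* T. Kato, *Strong `L^p`-solutions of the Navier–Stokes equation in `ℝ^m`, with applications to
  weak solutions*, Math. Z. 187 (1984), 471–480 (the existence class; uniqueness there only
  within the auxiliary class). Bib key `Kato1984`.
-/

noncomputable section

open MeasureTheory TopologicalSpace Set Function Filter Topology InnerProductSpace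
open scoped RealInnerProductSpace ENNReal NNReal

namespace Literature.Analysis.FluidPDE

variable {E : Type*} [NormedAddCommGroup E] [InnerProductSpace ℝ E] [FiniteDimensional ℝ E]
  [MeasurableSpace E] [BorelSpace E]

/-! ### Two facts about `C(S; L^p)` fields -/

section TimeContinuity

variable {F : Type*} [NormedAddCommGroup F]
variable {S : Set ℝ} {p : ℝ≥0∞}

/-- **Uniform `L^p` bound on compact time sets**: if `u ∈ C(S; L^p)`, `1 ≤ p`, and `K ⊆ S` is
compact, then `sup_{t ∈ K} ‖u t‖_{L^p} < ∞` (finite subcover by the sets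
`{t | ‖u t - u s‖_{L^p} < 1}` and the triangle inequality). [folklore] -/
theorem ContinuousInLpOn.exists_forall_eLpNorm_le {u : ℝ → E → F} (hu : ContinuousInLpOn S p u)
    (hp : 1 ≤ p) {K : Set ℝ} (hK : IsCompact K) (hKS : K ⊆ S) :
    ∃ M : ℝ≥0, ∀ t ∈ K, eLpNorm (u t) p volume ≤ M := by
  have huK : ContinuousInLpOn K p u := hu.mono hKS
  set U : ℝ → Set ℝ := fun s => {t | eLpNorm (u t - u s) p volume < 1} with hU_def
  have hU : ∀ s ∈ K, U s ∈ 𝓝[K] s := fun s hs => (huK.2 s hs) (Iio_mem_nhds one_pos)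
  obtain ⟨T, hTK, hcover⟩ := hK.elim_nhdsWithin_subcover U hU
  have hfin : ∀ s ∈ K, eLpNorm (u s) p volume < ⊤ := fun s hs => (huK.1 s hs).2
  set M : ℝ≥0∞ := ∑ s ∈ T, (1 + eLpNorm (u s) p volume) with hM_def
  have hMtop : M < ⊤ :=
    ENNReal.sum_lt_top.2 fun s hs => ENNReal.add_lt_top.2 ⟨ENNReal.one_lt_top, hfin s (hTK s hs)⟩
  refine ⟨M.toNNReal, fun t ht => ?_⟩
  rw [ENNReal.coe_toNNReal hMtop.ne]
  obtain ⟨s, hsT, hts⟩ : ∃ s ∈ T, t ∈ U s := by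
    have h := hcover ht
    simp only [mem_iUnion, exists_prop] at h
    exact h
  have hsK : s ∈ K := hTK s hsT
  calc eLpNorm (u t) p volume = eLpNorm ((u t - u s) + u s) p volume := by rw [sub_add_cancel]
    _ ≤ eLpNorm (u t - u s) p volume + eLpNorm (u s) p volume :=
        eLpNorm_add_le ((huK.1 t ht).1.sub (huK.1 s hsK).1) (huK.1 s hsK).1 hp
    _ ≤ 1 + eLpNorm (u s) p volume := by
        gcongr
        exact le_of_lt hts
    _ ≤ M := Finset.single_le_sum (f := fun s => 1 + eLpNorm (u s) p volume)
        (fun _ _ => zero_le) hsT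

/-- **A.e.-in-time coincidence is everywhere coincidence for `C(S; L^p)` fields.** If
`u, v ∈ C(S; L^p)`, `1 ≤ p`, `(a, b) ⊆ S`, and `u s = v s` a.e. in space for a.e. `s ∈ (a, b]`,
then `u s = v s` a.e. for **every** `s ∈ (a, b)`: a Lebesgue-null subset of `ℝ` has dense
complement (open intervals have positive measure), so every `s ∈ (a, b)` is a limit of
coincidence times, and the coincidence set is closed under `L^p`-continuity
(`ContinuousInLpOn.ae_eq_of_neBot`). [folklore] -/
theorem ContinuousInLpOn.ae_eq_of_ae_restrict_Ioc {u v : ℝ → E → E} (hp : 1 ≤ p)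
    (hu : ContinuousInLpOn S p u) (hv : ContinuousInLpOn S p v) {a b : ℝ} (hab : Ioo a b ⊆ S)
    (h : ∀ᵐ s ∂(volume.restrict (Ioc a b)), u s =ᵐ[volume] v s) :
    ∀ s ∈ Ioo a b, u s =ᵐ[volume] v s := by
  intro r hr
  refine hu.ae_eq_of_neBot hp hv (hab hr) ?_
  rw [← mem_closure_iff_nhdsWithin_neBot, Metric.mem_closure_iff]
  intro ε hε
  set I : Set ℝ := Ioo a b ∩ Ioo (r - ε) (r + ε) with hI
  have hIo : IsOpen I := isOpen_Ioo.inter isOpen_Ioo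
  have hrI : r ∈ I := ⟨hr, by constructor <;> linarith⟩
  have hIpos : 0 < volume I := hIo.measure_pos volume ⟨r, hrI⟩
  have hI' : ∀ᵐ s ∂(volume.restrict I), u s =ᵐ[volume] v s :=
    ae_restrict_of_ae_restrict_of_subset (inter_subset_left.trans Ioo_subset_Ioc_self) h
  have hne : (volume.restrict I : Measure ℝ) ≠ 0 := by
    intro h0
    rw [Measure.restrict_eq_zero] at h0
    exact hIpos.ne' h0
  haveI : (ae (volume.restrict I : Measure ℝ)).NeBot := ae_neBot.2 hne
  obtain ⟨s, hsZ, hsI⟩ := (hI'.and (ae_restrict_mem hIo.measurableSet)).exists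
  refine ⟨s, ⟨hab hsI.1, hsZ⟩, ?_⟩
  rw [Real.dist_eq, abs_sub_lt_iff]
  constructor <;> linarith [hsI.2.1, hsI.2.2]

end TimeContinuity

/-! ### The assembly: local forward uniqueness from the slab contraction estimate -/

section SlabEstimate

variable {ν T : ℝ} {u v : ℝ → E → E} {u₀ : E → E}

/-- **Local forward uniqueness on a slab from the contraction estimate** (Lemarié-Rieusset
2016, proof of Thm. 7.7, pp. 147–151, assembled): in dimension `3`, let `u, v` be unforced mild
solutions on `[0, T)` in `C([0,T); L³)`, measurable on `(0,T) × E`, agreeing a.e. at every time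
of `[0, τ₀]`, and suppose the slab contraction estimate holds on `(τ₀, τ₁] ⊆ (τ₀, T)` with some
`κ < 1`. Then `u s = v s` a.e. for every `s ∈ [τ₀, τ₁)`. Proof: `w = u - v` is jointly
measurable on the slab, has `L²` slices bounded uniformly on `[0, τ₁]`
(`IsMildNSSolutionOn.exists_eLpNorm_two_sub_le`, the `L³` bound coming from compactness of
`[0, τ₁]`, `ContinuousInLpOn.exists_forall_eLpNorm_le`) which are weakly divergence free, so the
closing step `ae_eq_zero_of_forall_abs_integral_inner_le_mul_sqrt_of_eLpNorm_le` gives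
`w t = 0` a.e. for a.e. `t ∈ (τ₀, τ₁]`, and `ContinuousInLpOn.ae_eq_of_ae_restrict_Ioc` upgrades
this to every `t ∈ (τ₀, τ₁)`; `t = τ₀` is a hypothesis. [cite: LemarieRieusset2016, proof of Thm. 7.7, pp. 147–151] -/
theorem IsMildNSSolutionOn.ae_eq_Ico_of_slab_estimate (hd : Module.finrank ℝ E = 3) (hν : 0 < ν)
    (h₁ : IsMildNSSolutionOn (Ico 0 T) ν 0 u₀ u) (h₂ : IsMildNSSolutionOn (Ico 0 T) ν 0 u₀ v)
    (hu : ContinuousInLpOn (Ico 0 T) 3 u) (hv : ContinuousInLpOn (Ico 0 T) 3 v)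
    (hmu : AEStronglyMeasurable (uncurry u) (volume.restrict (Ioo 0 T ×ˢ univ)))
    (hmv : AEStronglyMeasurable (uncurry v) (volume.restrict (Ioo 0 T ×ˢ univ)))
    {τ₀ : ℝ} (hτ₀ : τ₀ ∈ Ico 0 T) (hco : ∀ s ∈ Icc 0 τ₀, u s =ᵐ[volume] v s)
    {τ₁ : ℝ} (hτ₁ : τ₁ < T) {κ : ℝ} (hκ : κ < 1)
    (hbd : ∀ (Θ : ℝ → E → E) (a b : ℝ), IsSpaceTimeTestOn (⊤ : Opens (ℝ × E)) Θ →
      (∀ t, VectorCalculus.IsDivFree (Θ t)) → τ₀ < a → b < τ₁ → (∀ t, t ∉ Icc a b → Θ t = 0) →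
      |∫ t in Ioc τ₀ τ₁, ∫ x, ⟪u t x - v t x, Θ t x⟫| ≤
        κ * Real.sqrt (∫ t in Ioc τ₀ τ₁, ∫ x, ‖u t x - v t x‖ ^ 2) *
          Real.sqrt (∫ t in Ioc τ₀ τ₁, ∫ x, ‖Θ t x‖ ^ 2)) :
    ∀ s ∈ Ico τ₀ τ₁, u s =ᵐ[volume] v s := by
  have h3 : (1 : ℝ≥0∞) ≤ 3 := by norm_num
  -- uniform `L³` bound on `[0, τ₁]`
  have hK : IsCompact (Icc 0 τ₁) := isCompact_Icc
  have hKS : Icc 0 τ₁ ⊆ Ico 0 T := fun t ht => ⟨ht.1, ht.2.trans_lt hτ₁⟩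
  obtain ⟨Mu, hMu⟩ := hu.exists_forall_eLpNorm_le h3 hK hKS
  obtain ⟨Mv, hMv⟩ := hv.exists_forall_eLpNorm_le h3 hK hKS
  have hu3 : ∀ τ ∈ Icc 0 τ₁, MemLp (u τ) 3 (volume : Measure E) ∧
      eLpNorm (u τ) 3 volume ≤ max Mu Mv := fun τ hτ =>
    ⟨hu.1 τ (hKS hτ), (hMu τ hτ).trans (by exact_mod_cast le_max_left _ _)⟩
  have hv3 : ∀ τ ∈ Icc 0 τ₁, MemLp (v τ) 3 (volume : Measure E) ∧
      eLpNorm (v τ) 3 volume ≤ max Mu Mv := fun τ hτ =>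
    ⟨hv.1 τ (hKS hτ), (hMv τ hτ).trans (by exact_mod_cast le_max_right _ _)⟩
  -- a priori `L²` bound on the difference
  obtain ⟨A, hA⟩ := h₁.exists_eLpNorm_two_sub_le hd hν h₂ hmu hmv hτ₁ hu3 hv3
  -- the difference on the slab `(τ₀, τ₁] × E`
  set w : ℝ → E → E := fun t x => u t x - v t x with hw
  have hwm : AEStronglyMeasurable (uncurry w)
      ((volume.restrict (Ioc τ₀ τ₁)).prod (volume : Measure E)) :=
    (aestronglyMeasurable_uncurry_restrict_Ioc hτ₀.1 hτ₁ hmu).sub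
      (aestronglyMeasurable_uncurry_restrict_Ioc hτ₀.1 hτ₁ hmv)
  have hw2 : ∀ t ∈ Ioc τ₀ τ₁, MemLp (w t) 2 (volume : Measure E) ∧
      eLpNorm (w t) 2 volume ≤ ENNReal.ofReal A := fun t ht =>
    hA t ⟨hτ₀.1.trans ht.1.le, ht.2⟩
  have hwdiv : ∀ t ∈ Ioc τ₀ τ₁, IsWeaklyDivFree (w t) := fun t ht => by
    have htT : t ∈ Ico 0 T := ⟨hτ₀.1.trans ht.1.le, ht.2.trans_lt hτ₁⟩
    exact (h₁.1 t htT).sub h3 (h₂.1 t htT) (hu.1 t htT) (hv.1 t htT)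
  have hae := ae_eq_zero_of_forall_abs_integral_inner_le_mul_sqrt_of_eLpNorm_le hwm
    ENNReal.ofReal_ne_top hw2 hwdiv hκ hbd
  have hae' : ∀ᵐ t ∂(volume.restrict (Ioc τ₀ τ₁)), u t =ᵐ[volume] v t := by
    filter_upwards [hae] with t ht
    filter_upwards [ht] with x hx
    exact sub_eq_zero.1 hx
  have hIoo : Ioo τ₀ τ₁ ⊆ Ico 0 T := fun t ht => ⟨hτ₀.1.trans ht.1.le, ht.2.trans hτ₁⟩
  have hopen := ContinuousInLpOn.ae_eq_of_ae_restrict_Ioc h3 hu hv hIoo hae'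
  intro s hs
  rcases eq_or_lt_of_le hs.1 with h | h
  · rw [← h]
    exact hco τ₀ ⟨hτ₀.1, le_rfl⟩
  · exact hopen s ⟨h, hs.2⟩

end SlabEstimate


/-! ### Bookkeeping: the `L²` norm of the slab as an iterated `lintegral` -/

/-- For `w` square integrable on the slab `(τ₀, τ₁] × E`,
`∫⁻_{(τ₀,τ₁]} ∫⁻ ‖w‖ₑ² = ofReal (∫_{(τ₀,τ₁]} ∫ ‖w‖²)` (Tonelli and `‖a‖ₑ² = ofReal ‖a‖²`). [folklore] -/
theorem lintegral_lintegral_enorm_sq_eq_ofReal {τ₀ τ₁ : ℝ} {w : ℝ → E → E}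
    (hW : MemLp (uncurry w) 2 ((volume.restrict (Ioc τ₀ τ₁)).prod (volume : Measure E))) :
    (∫⁻ τ in Ioc τ₀ τ₁, ∫⁻ x, ‖w τ x‖ₑ ^ (2 : ℝ)) =
      ENNReal.ofReal (∫ t in Ioc τ₀ τ₁, ∫ x, ‖w t x‖ ^ 2) := by
  set μ : Measure (ℝ × E) := (volume.restrict (Ioc τ₀ τ₁)).prod (volume : Measure E) with hμ
  have hI : Integrable (fun p : ℝ × E => ‖uncurry w p‖ ^ 2) μ :=
    (memLp_two_iff_integrable_sq_norm hW.1).1 hW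
  have h1 : ∫ t in Ioc τ₀ τ₁, ∫ x, ‖w t x‖ ^ 2 = ∫ p, ‖uncurry w p‖ ^ 2 ∂μ :=
    (integral_prod _ hI).symm
  have h2 : AEMeasurable (fun p : ℝ × E => ENNReal.ofReal (‖uncurry w p‖ ^ 2)) μ :=
    (hW.1.norm.aemeasurable.pow_const 2).ennreal_ofReal
  rw [h1, ofReal_integral_eq_lintegral_ofReal hI (Eventually.of_forall fun _ => by positivity),
    lintegral_prod _ h2]
  refine lintegral_congr fun τ => lintegral_congr fun x => ?_
  rw [enorm_rpow_two_eq_ofReal_sq]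
  rfl

/-! ### The discharge -/

section Discharge

variable {ν T : ℝ} {u v : ℝ → E → E} {u₀ : E → E}

/-- **Local forward uniqueness of mild solutions in `C([0,T); L³)`, PROVED**
(Furioli–Lemarié-Rieusset–Terraneo 2000, Thm. 1; Lemarié-Rieusset 2016, proof of Thm. 7.7,
pp. 147–151): the named fact `IsMildNSSolutionOn.ae_eq_Ico_of_ae_eq_Icc_three` of
`KatoUniqueness.lean` holds. Choice of parameters in `IsMildNSSolutionOn.enorm_slab_duality_le`
(see the module docstring) and the assembly `IsMildNSSolutionOn.ae_eq_Ico_of_slab_estimate`. [cite: LemarieRieusset2016, Thm. 7.7 (p. 147) and its proof, pp. 147–151] -/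
theorem IsMildNSSolutionOn.ae_eq_Ico_of_ae_eq_Icc_three_holds :
    IsMildNSSolutionOn.ae_eq_Ico_of_ae_eq_Icc_three (E := E) (ν := ν) (T := T) (u := u)
      (v := v) (u₀ := u₀) := by
  intro hd hν hu₀ h₁ h₂ hu hv hmu hmv τ₀ hτ₀ hco
  have h3 : (1 : ℝ≥0∞) ≤ 3 := by norm_num
  have h3' : (3 : ℝ≥0∞) ≠ ⊤ := ENNReal.ofNat_ne_top
  -- a compact time window `[0, T']`, `τ₀ < T' < T`
  set T' : ℝ := (τ₀ + T) / 2 with hT'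
  have hτ₀T' : τ₀ < T' := by rw [hT']; linarith [hτ₀.2]
  have hT'T : T' < T := by rw [hT']; linarith [hτ₀.2]
  have hK : IsCompact (Icc 0 T') := isCompact_Icc
  have hKS : Icc 0 T' ⊆ Ico 0 T := fun t ht => ⟨ht.1, ht.2.trans_lt hT'T⟩
  -- uniform `L³` bounds on `[0, T']`
  obtain ⟨Mu, hMu⟩ := hu.exists_forall_eLpNorm_le h3 hK hKS
  obtain ⟨Mv, hMv⟩ := hv.exists_forall_eLpNorm_le h3 hK hKS
  -- the Sobolev constant and the tail size `ε`
  set Kc : ℝ≥0 := SNormLESNormFDerivOfEqConst E (volume : Measure E) 2 with hKc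
  set A : ℝ := 2 * (3 * (Kc : ℝ)) * (3 / ν ^ 2) ^ (1 / 2 : ℝ) with hA
  have hA0 : 0 ≤ A := by positivity
  set ε : ℝ := 1 / (4 * A + 4) with hε
  have hε0 : 0 < ε := by positivity
  have hεA : ε * A ≤ 1 / 4 := by
    rw [hε, div_mul_eq_mul_div, one_mul, div_le_iff₀ (by positivity)]
    linarith
  -- a common height `λ` for the `L³` tails of `u` and `v` on `[0, T']`
  obtain ⟨Cu, hCu⟩ := (hu.mono hKS).exists_forall_eLpNorm_indicator_le hK h3 h3' hε0
  obtain ⟨Cv, hCv⟩ := (hv.mono hKS).exists_forall_eLpNorm_indicator_le hK h3 h3' hε0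
  set lam : ℝ≥0 := max Cu Cv with hlam
  have htail : ∀ (f : E → E) (C : ℝ≥0), C ≤ lam →
      eLpNorm ({y | lam ≤ ‖f y‖₊}.indicator f) 3 (volume : Measure E) ≤
        eLpNorm ({y | C ≤ ‖f y‖₊}.indicator f) 3 volume := fun f C hC =>
    eLpNorm_mono fun x => norm_indicator_le_of_subset (fun y hy => hC.trans hy) f x
  have hut' : ∀ τ ∈ Icc 0 T',
      eLpNorm ({y | lam ≤ ‖u τ y‖₊}.indicator (u τ)) 3 (volume : Measure E) ≤ (ε.toNNReal : ℝ≥0∞) :=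
    fun τ hτ => (htail (u τ) Cu (le_max_left _ _)).trans (hCu τ hτ)
  have hvt' : ∀ τ ∈ Icc 0 T',
      eLpNorm ({y | lam ≤ ‖v τ y‖₊}.indicator (v τ)) 3 (volume : Measure E) ≤ (ε.toNNReal : ℝ≥0∞) :=
    fun τ hτ => (htail (v τ) Cv (le_max_right _ _)).trans (hCv τ hτ)
  -- the time step
  set δ : ℝ := ν / (128 * (lam : ℝ) ^ 2 + 1) with hδ
  have hδ0 : 0 < δ := by positivity
  set τ₁ : ℝ := min T' (τ₀ + δ) with hτ₁
  have hτ₀₁ : τ₀ < τ₁ := lt_min hτ₀T' (by linarith)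
  have hτ₁T' : τ₁ ≤ T' := min_le_left _ _
  have hτ₁T : τ₁ < T := hτ₁T'.trans_lt hT'T
  have hτ₁δ : τ₁ - τ₀ ≤ δ := by linarith [min_le_right T' (τ₀ + δ)]
  -- the second smallness: `2λ (2(τ₁-τ₀)/ν)^{1/2} ≤ 1/4`
  set B : ℝ := 2 * (lam : ℝ) * (2 * (τ₁ - τ₀) / ν) ^ (1 / 2 : ℝ) with hB
  have hB4 : B ≤ 1 / 4 := by
    have hx0 : 0 ≤ 2 * (τ₁ - τ₀) / ν := by
      have : 0 ≤ τ₁ - τ₀ := by linarith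
      positivity
    have hx : 2 * (τ₁ - τ₀) / ν ≤ 2 * δ / ν := by gcongr
    have hsq : (2 * (lam : ℝ)) ^ 2 * (2 * δ / ν) ≤ (1 / 4) ^ 2 := by
      rw [hδ]
      have hl : 0 ≤ (lam : ℝ) := lam.coe_nonneg
      rw [show (2 * (lam : ℝ)) ^ 2 * (2 * (ν / (128 * (lam : ℝ) ^ 2 + 1)) / ν) =
        8 * (lam : ℝ) ^ 2 / (128 * (lam : ℝ) ^ 2 + 1) by field_simp; ring]
      rw [div_le_iff₀ (by positivity)]
      nlinarith
    calc B = 2 * (lam : ℝ) * Real.sqrt (2 * (τ₁ - τ₀) / ν) := by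
          rw [hB, Real.sqrt_eq_rpow]
      _ ≤ 2 * (lam : ℝ) * Real.sqrt (2 * δ / ν) := by gcongr
      _ = Real.sqrt ((2 * (lam : ℝ)) ^ 2 * (2 * δ / ν)) := by
          rw [Real.sqrt_mul (sq_nonneg _), Real.sqrt_sq (by positivity)]
      _ ≤ Real.sqrt ((1 / 4) ^ 2) := Real.sqrt_le_sqrt hsq
      _ = 1 / 4 := Real.sqrt_sq (by norm_num)
  -- the contraction constant
  set κ : ℝ := 2 * ε * (3 * (Kc : ℝ)) * (3 / ν ^ 2) ^ (1 / 2 : ℝ) + B with hκ_def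
  have hκ : κ < 1 := by
    have : 2 * ε * (3 * (Kc : ℝ)) * (3 / ν ^ 2) ^ (1 / 2 : ℝ) = ε * A := by rw [hA]; ring
    linarith
  -- the assembly
  refine ⟨τ₁ - τ₀, sub_pos.2 hτ₀₁, fun s hs _ => ?_⟩
  refine h₁.ae_eq_Ico_of_slab_estimate hd hν h₂ hu hv hmu hmv hτ₀ hco hτ₁T hκ ?_ s
    ⟨hs.1, by linarith [hs.2]⟩
  intro Θ a b hΘ hΘd ha hb hab
  -- `L³` bounds and tails on `[0, τ₁] ⊆ [0, T']`
  have hu3 : ∀ τ ∈ Icc 0 τ₁, MemLp (u τ) 3 (volume : Measure E) ∧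
      eLpNorm (u τ) 3 volume ≤ max Mu Mv := fun τ hτ =>
    ⟨hu.1 τ (hKS ⟨hτ.1, hτ.2.trans hτ₁T'⟩),
      (hMu τ ⟨hτ.1, hτ.2.trans hτ₁T'⟩).trans (by exact_mod_cast le_max_left _ _)⟩
  have hv3 : ∀ τ ∈ Icc 0 τ₁, MemLp (v τ) 3 (volume : Measure E) ∧
      eLpNorm (v τ) 3 volume ≤ max Mu Mv := fun τ hτ =>
    ⟨hv.1 τ (hKS ⟨hτ.1, hτ.2.trans hτ₁T'⟩),
      (hMv τ ⟨hτ.1, hτ.2.trans hτ₁T'⟩).trans (by exact_mod_cast le_max_right _ _)⟩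
  have hut : ∀ τ ∈ Icc τ₀ τ₁,
      eLpNorm ({y | lam ≤ ‖u τ y‖₊}.indicator (u τ)) 3 (volume : Measure E) ≤ (ε.toNNReal : ℝ≥0∞) :=
    fun τ hτ => hut' τ ⟨hτ₀.1.trans hτ.1, hτ.2.trans hτ₁T'⟩
  have hvt : ∀ τ ∈ Icc τ₀ τ₁,
      eLpNorm ({y | lam ≤ ‖v τ y‖₊}.indicator (v τ)) 3 (volume : Measure E) ≤ (ε.toNNReal : ℝ≥0∞) :=
    fun τ hτ => hvt' τ ⟨hτ₀.1.trans hτ.1, hτ.2.trans hτ₁T'⟩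
  -- the smallness estimate (`KatoUniquenessEstimate.lean`)
  have hest := h₁.enorm_slab_duality_le hd hν hΘ hΘd h₂ hmu hmv hτ₀.1 hτ₀₁.le hτ₁T hu3 hv3 hco
    hab hb.le hut hvt
  -- bookkeeping: everything is finite and real
  obtain ⟨A2, hA2⟩ := h₁.exists_eLpNorm_two_sub_le hd hν h₂ hmu hmv hτ₁T hu3 hv3
  have hwm : AEStronglyMeasurable (uncurry fun t x => u t x - v t x)
      ((volume.restrict (Ioc τ₀ τ₁)).prod (volume : Measure E)) :=
    (aestronglyMeasurable_uncurry_restrict_Ioc hτ₀.1 hτ₁T hmu).sub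
      (aestronglyMeasurable_uncurry_restrict_Ioc hτ₀.1 hτ₁T hmv)
  have hW : MemLp (uncurry fun t x => u t x - v t x) 2
      ((volume.restrict (Ioc τ₀ τ₁)).prod (volume : Measure E)) :=
    memLp_two_uncurry_of_eLpNorm_slice_le hwm ENNReal.ofReal_ne_top
      fun t ht => (hA2 t ⟨hτ₀.1.trans ht.1.le, ht.2⟩).2
  set Sw : ℝ := ∫ t in Ioc τ₀ τ₁, ∫ x, ‖u t x - v t x‖ ^ 2 with hSw_def
  set SΘ : ℝ := ∫ t in Ioc τ₀ τ₁, ∫ x, ‖Θ t x‖ ^ 2 with hSΘ_def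
  have hSw0 : 0 ≤ Sw := integral_nonneg fun _ => integral_nonneg fun _ => by positivity
  have hSΘ0 : 0 ≤ SΘ := integral_nonneg fun _ => integral_nonneg fun _ => by positivity
  have hSw : (∫⁻ τ in Ioc τ₀ τ₁, ∫⁻ x, ‖u τ x - v τ x‖ₑ ^ (2 : ℝ)) = ENNReal.ofReal Sw :=
    lintegral_lintegral_enorm_sq_eq_ofReal hW
  rw [hSw, intervalIntegral.integral_of_le hτ₀₁.le, Real.enorm_eq_ofReal_abs,
    ENNReal.ofReal_rpow_of_nonneg hSw0 (by norm_num),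
    ENNReal.ofReal_rpow_of_nonneg hSΘ0 (by norm_num)] at hest
  -- the constant of the estimate, as a real number
  set Coef : ℝ≥0∞ := 2 * (ε.toNNReal : ℝ≥0∞) *
      ((Module.finrank ℝ E : ℝ≥0∞) * (SNormLESNormFDerivOfEqConst E (volume : Measure E) 2 : ℝ≥0)) *
        ENNReal.ofReal ((Module.finrank ℝ E : ℝ) / ν ^ 2) ^ (1 / 2 : ℝ) +
      2 * (lam : ℝ≥0∞) * ENNReal.ofReal (2 * (τ₁ - τ₀) / ν) ^ (1 / 2 : ℝ) with hCoef_def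
  have hx0 : 0 ≤ 2 * (τ₁ - τ₀) / ν := by
    have : 0 ≤ τ₁ - τ₀ := by linarith
    positivity
  have hCoef_top : Coef ≠ ⊤ := by
    rw [hCoef_def]
    finiteness
  have hCoef : Coef.toReal = κ := by
    rw [hCoef_def, hκ_def, hB, hd, ← hKc]
    push_cast
    rw [ENNReal.ofReal_rpow_of_nonneg (by positivity) (by norm_num),
      ENNReal.ofReal_rpow_of_nonneg hx0 (by norm_num),
      ENNReal.toReal_add (by finiteness) (by finiteness)]
    simp only [ENNReal.toReal_mul, ENNReal.toReal_ofNat, ENNReal.coe_toReal]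
    rw [ENNReal.toReal_ofReal (by positivity), ENNReal.toReal_ofReal (by positivity),
      Real.coe_toNNReal ε hε0.le]
  -- pass to real numbers
  have hR : Coef * ENNReal.ofReal (Sw ^ (1 / 2 : ℝ)) * ENNReal.ofReal (SΘ ^ (1 / 2 : ℝ)) ≠ ⊤ :=
    ENNReal.mul_ne_top (ENNReal.mul_ne_top hCoef_top ENNReal.ofReal_ne_top) ENNReal.ofReal_ne_top
  have hfin := ENNReal.toReal_mono hR hest
  rw [ENNReal.toReal_ofReal (abs_nonneg _), ENNReal.toReal_mul, ENNReal.toReal_mul, hCoef,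
    ENNReal.toReal_ofReal (by positivity), ENNReal.toReal_ofReal (by positivity),
    ← Real.sqrt_eq_rpow, ← Real.sqrt_eq_rpow] at hfin
  exact hfin

/-- **Uniqueness of mild solutions in `C([0,T); L³)`, PROVED** (Furioli–Lemarié-Rieusset–Terraneo
2000, Thm. 1; Lemarié-Rieusset 2016, Thm. 7.7): the accepted fact
`Fluid.IsMildNSSolutionOn.ae_eq_of_continuousInLpOn_three` of `MildSolution.lean` holds — local
forward uniqueness (`…_three_holds` above) fed into the continuation argument
`IsMildNSSolutionOn.ae_eq_of_continuousInLpOn_three_of` of `KatoUniqueness.lean`. [cite: FurioliLemarierieussetTerraneo2000, Théorème 1, p. 606] -/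
theorem IsMildNSSolutionOn.ae_eq_of_continuousInLpOn_three_holds :
    IsMildNSSolutionOn.ae_eq_of_continuousInLpOn_three (E := E) (ν := ν) (T := T) (u := u)
      (v := v) (u₀ := u₀) :=
  IsMildNSSolutionOn.ae_eq_of_continuousInLpOn_three_of
    IsMildNSSolutionOn.ae_eq_Ico_of_ae_eq_Icc_three_holds

end Discharge

end Literature.Analysis.FluidPDE

/-! ### `ℝ³`: ns.S13 -/

namespace Literature.Analysis.FluidPDE

/-- **`kato_unique` (ns.S13), PROVED**: uniqueness of mild solutions of the Navier–Stokes
equations in `C([0,T); L³(ℝ³))` (Furioli–Lemarié-Rieusset–Terraneo 2000, Thm. 1; the class is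
Kato's 1984 existence class), from the local forward-uniqueness theorem on `ℝ³` via
`kato_unique_of` (`KatoUniqueness.lean`). [cite: FurioliLemarierieussetTerraneo2000, Théorème 1, p. 606] -/
theorem kato_unique_holds : kato_unique :=
  kato_unique_of fun {_ _ _ _ _} => IsMildNSSolutionOn.ae_eq_Ico_of_ae_eq_Icc_three_holds

end Literature.Analysis.FluidPDE
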